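import Summits.Parity.BatemanHorn.Theorems.SystemLSDRealSegment.Negative.DivisorBound

/-!
# `LSDRealSegment` — negative-side support: the odd divisor sum `Σ_{n ≤ M odd} d(n) ≥ (M/4) log M - 2M`

Elementary arithmetic used by the standing disprover of the crux
`Summit.Parity.BatemanHorn.Theses.SelbergDelangeRigidity.LSDRealSegment` (stmt-Parity-9770) for the SHARP wall at `y = 2`
(`WallAtTwoSharp.lean`: `x⁻¹ (log x)^{-1} Σ_{n ≤ x} 2^{Ω(n)} → ∞`), from `Cruxes/LSDRealSegment/Disproof.lean` §5b:
`d(n) ≤ 2^{Ω(n)}`, `Ω(2^j m) = j + Ω(m)`, the odd numbers of `[1, M]` as `{2c - 1}`, `Σ_{a ≤ M odd} 1/a ≥ ½(log M - log 2)`,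
and the odd hyperbola count `Σ_{n ≤ M odd} d(n) = Σ_a #{n ≤ M odd : a ∣ n} ≥ Σ_{a odd} #{b ≤ M/a odd} ≥ (M/4) log M - 2M`
(`sum_odd_card_divisors_ge`). Crude, no asymptotics (truth: `~ (M/4) log M`). `log_le_sum_inv` is imported from the
sibling's `DivisorBound.lean`.
-/

open Filter Finset
open scoped Topology

namespace Summit.Parity.BatemanHorn.Theorems.LSDRealSegment.Negative

open Summit.Parity.BatemanHorn.Theorems.SystemLSDRealSegment.Negative
open ArithmeticFunction (cardFactors)

/-! ### Step 1: `d(n) ≤ 2^{Ω(n)}` and `Ω(2^j m) = j + Ω(m)` -/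

/-- `d(n) ≤ 2^{Ω(n)}` (`v + 1 ≤ 2^v` prime by prime). [folklore] -/
theorem card_divisors_le_two_pow_cardFactors {n : ℕ} (hn : n ≠ 0) : n.divisors.card ≤ 2 ^ cardFactors n := by
  rw [Nat.card_divisors hn, ArithmeticFunction.cardFactors_eq_sum_factorization, Finsupp.sum,
    ← Finset.prod_pow_eq_pow_sum, Nat.support_factorization]
  refine Finset.prod_le_prod (fun _ _ => Nat.zero_le _) fun p _ => ?_
  exact Nat.lt_two_pow_self

/-- `Ω(2^j m) = j + Ω(m)` for `m ≠ 0`. [folklore] -/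
theorem cardFactors_two_pow_mul (j : ℕ) {m : ℕ} (hm : m ≠ 0) : cardFactors (2 ^ j * m) = j + cardFactors m := by
  rw [ArithmeticFunction.cardFactors_mul (pow_ne_zero _ two_ne_zero) hm,
    ArithmeticFunction.cardFactors_apply_prime_pow Nat.prime_two]

/-! ### Step 2: the odd numbers of `[1, M]` as the image of `c ↦ 2c - 1` -/

/-- `{n ∈ [1, M] : n odd} = {2c - 1 : c ∈ [1, (M+1)/2]}`. [folklore] -/
theorem filter_odd_Icc_eq_image (M : ℕ) :
    (Icc 1 M).filter Odd = (Icc 1 ((M + 1) / 2)).image fun c => 2 * c - 1 := by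
  ext n
  simp only [Finset.mem_filter, Finset.mem_Icc, Finset.mem_image]
  constructor
  · rintro ⟨⟨h1, hM⟩, ⟨c, rfl⟩⟩
    exact ⟨c + 1, ⟨by omega, by omega⟩, by omega⟩
  · rintro ⟨c, ⟨hc1, hcM⟩, rfl⟩
    exact ⟨⟨by omega, by omega⟩, ⟨c - 1, by omega⟩⟩

/-- `c ↦ 2c - 1` is injective on `ℕ`. [folklore] -/
theorem two_mul_sub_one_injective : Function.Injective fun c : ℕ => 2 * c - 1 := by
  intro a b h
  simp only at h
  omega

/-- There are `(M+1)/2 ≥ M/2` odd numbers in `[1, M]`. [folklore] -/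
theorem card_filter_odd_Icc (M : ℕ) : ((Icc 1 M).filter Odd).card = (M + 1) / 2 := by
  rw [filter_odd_Icc_eq_image, Finset.card_image_of_injective _ two_mul_sub_one_injective, Nat.card_Icc,
    Nat.add_sub_cancel]

/-- … hence at least `M/2` of them. [folklore] -/
theorem half_le_card_filter_odd_Icc (M : ℕ) : (M : ℝ) / 2 ≤ ((Icc 1 M).filter Odd).card := by
  rw [card_filter_odd_Icc]
  have h : M ≤ (M + 1) / 2 * 2 := by omega
  have : (M : ℝ) ≤ ((M + 1) / 2 : ℕ) * 2 := by exact_mod_cast h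
  linarith

/-- `Σ_{a ≤ M odd} 1/a ≥ ½ (log M - log 2)` (pair `2c-1` with `2c`). [folklore] -/
theorem sum_inv_odd_ge (M : ℕ) (hM : 1 ≤ M) :
    (Real.log M - Real.log 2) / 2 ≤ ∑ a ∈ (Icc 1 M).filter Odd, (1 : ℝ) / a := by
  rw [filter_odd_Icc_eq_image, Finset.sum_image fun a _ b _ h => two_mul_sub_one_injective h]
  set L := (M + 1) / 2 with hL
  have hL1 : 1 ≤ L := by omega
  have hLM : (M : ℝ) / 2 ≤ L := by
    have h : M ≤ (M + 1) / 2 * 2 := by omega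
    have : (M : ℝ) ≤ ((M + 1) / 2 : ℕ) * 2 := by exact_mod_cast h
    rw [hL]; linarith
  have h1 : ∑ c ∈ Icc 1 L, (1 : ℝ) / (2 * c) ≤ ∑ c ∈ Icc 1 L, (1 : ℝ) / ((2 * c - 1 : ℕ) : ℝ) := by
    refine Finset.sum_le_sum fun c hc => ?_
    rw [Finset.mem_Icc] at hc
    have hc' : ((2 * c - 1 : ℕ) : ℝ) = 2 * c - 1 := by
      rw [Nat.cast_sub (by omega)]; push_cast; ring
    rw [hc']
    have : (1 : ℝ) ≤ c := by exact_mod_cast hc.1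
    exact one_div_le_one_div_of_le (by linarith) (by linarith)
  have h2 : ∑ c ∈ Icc 1 L, (1 : ℝ) / (2 * c) = (1 / 2) * ∑ c ∈ Icc 1 L, (1 : ℝ) / c := by
    rw [Finset.mul_sum]
    refine Finset.sum_congr rfl fun c _ => ?_
    ring
  have h3 := log_le_sum_inv L
  have h4 : Real.log M - Real.log 2 ≤ Real.log L := by
    have hM0 : (0 : ℝ) < M := by exact_mod_cast hM
    rw [← Real.log_div hM0.ne' two_ne_zero]
    exact Real.log_le_log (by positivity) hLM
  calc (Real.log M - Real.log 2) / 2 ≤ (1 / 2) * ∑ c ∈ Icc 1 L, (1 : ℝ) / c := by linarith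
    _ = ∑ c ∈ Icc 1 L, (1 : ℝ) / (2 * c) := h2.symm
    _ ≤ _ := h1

/-! ### Step 3: the odd divisor sum `Σ_{n ≤ M odd} d(n) ≥ (M/4) log M - 2M` -/

/-- Double counting: `Σ_{n ≤ M odd} d(n) = Σ_{a ≤ M} #{n ≤ M odd : a ∣ n}`. [folklore] -/
theorem sum_odd_card_divisors (M : ℕ) :
    ∑ n ∈ (Icc 1 M).filter Odd, n.divisors.card =
      ∑ a ∈ Icc 1 M, (((Icc 1 M).filter Odd).filter fun n => a ∣ n).card := by
  have hL : ∀ n ∈ (Icc 1 M).filter Odd, n.divisors.card = ∑ a ∈ Icc 1 M, if a ∣ n then 1 else 0 := by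
    intro n hn
    simp only [Finset.mem_filter, Finset.mem_Icc] at hn
    rw [← Finset.card_filter]
    congr 1
    ext a
    simp only [Nat.mem_divisors, Finset.mem_filter, Finset.mem_Icc]
    constructor
    · rintro ⟨ha, -⟩
      exact ⟨⟨Nat.pos_of_dvd_of_pos ha (by omega), (Nat.le_of_dvd (by omega) ha).trans hn.1.2⟩, ha⟩
    · rintro ⟨-, ha⟩
      exact ⟨ha, by omega⟩
  have hR : ∀ a ∈ Icc 1 M, (((Icc 1 M).filter Odd).filter fun n => a ∣ n).card =
      ∑ n ∈ (Icc 1 M).filter Odd, if a ∣ n then 1 else 0 := by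
    intro a _
    rw [← Finset.card_filter]
  rw [Finset.sum_congr rfl hL, Finset.sum_congr rfl hR, Finset.sum_comm]

/-- For odd `a ∈ [1, M]`: `#{n ≤ M odd : a ∣ n} ≥ #{b ≤ M/a odd}` (`b ↦ ab`). [folklore] -/
theorem card_odd_multiples_ge {M a : ℕ} (ha : a ∈ (Icc 1 M).filter Odd) :
    ((Icc 1 (M / a)).filter Odd).card ≤ (((Icc 1 M).filter Odd).filter fun n => a ∣ n).card := by
  simp only [Finset.mem_filter, Finset.mem_Icc] at ha
  obtain ⟨⟨ha1, haM⟩, haodd⟩ := ha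
  refine Finset.card_le_card_of_injOn (fun b => a * b) (fun b hb => ?_) fun b₁ _ b₂ _ h => ?_
  · simp only [Finset.coe_filter, Finset.mem_Icc, Set.mem_setOf_eq, Finset.mem_filter] at hb ⊢
    obtain ⟨⟨hb1, hbM⟩, hbodd⟩ := hb
    refine ⟨⟨⟨Nat.mul_pos ha1 hb1, ?_⟩, haodd.mul hbodd⟩, dvd_mul_right a b⟩
    calc a * b ≤ a * (M / a) := Nat.mul_le_mul_left a hbM
      _ ≤ M := Nat.mul_div_le M a
  · exact Nat.eq_of_mul_eq_mul_left ha1 h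

/-- `Σ_{n ≤ M odd} d(n) ≥ (M/4) log M - 2M`. [folklore] -/
theorem sum_odd_card_divisors_ge (M : ℕ) :
    (M : ℝ) / 4 * Real.log M - 2 * M ≤ ∑ n ∈ (Icc 1 M).filter Odd, (n.divisors.card : ℝ) := by
  rcases Nat.eq_zero_or_pos M with rfl | hM
  · simp
  have hnat : ∑ a ∈ (Icc 1 M).filter Odd, ((Icc 1 (M / a)).filter Odd).card ≤
      ∑ n ∈ (Icc 1 M).filter Odd, n.divisors.card := by
    rw [sum_odd_card_divisors]
    calc ∑ a ∈ (Icc 1 M).filter Odd, ((Icc 1 (M / a)).filter Odd).card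
        ≤ ∑ a ∈ (Icc 1 M).filter Odd, (((Icc 1 M).filter Odd).filter fun n => a ∣ n).card :=
          Finset.sum_le_sum fun a ha => card_odd_multiples_ge ha
      _ ≤ ∑ a ∈ Icc 1 M, (((Icc 1 M).filter Odd).filter fun n => a ∣ n).card :=
          Finset.sum_le_sum_of_subset_of_nonneg (Finset.filter_subset _ _) fun _ _ _ => Nat.zero_le _
  have h1 : (∑ a ∈ (Icc 1 M).filter Odd, (((Icc 1 (M / a)).filter Odd).card : ℝ)) ≤
      ∑ n ∈ (Icc 1 M).filter Odd, (n.divisors.card : ℝ) := by exact_mod_cast hnat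
  have h2 : ∀ a ∈ (Icc 1 M).filter Odd, (M : ℝ) / (2 * a) - 1 ≤ (((Icc 1 (M / a)).filter Odd).card : ℝ) := by
    intro a ha
    simp only [Finset.mem_filter, Finset.mem_Icc] at ha
    have ha0 : (0 : ℝ) < a := by exact_mod_cast ha.1.1
    refine le_trans ?_ (half_le_card_filter_odd_Icc (M / a))
    have h := Nat.lt_div_mul_add (a := M) (b := a) ha.1.1
    have h' : (M : ℝ) < (M / a : ℕ) * a + a := by exact_mod_cast h
    rw [div_sub_one (by positivity), div_le_div_iff₀ (by positivity) (by norm_num)]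
    nlinarith
  have h3 : ∑ a ∈ (Icc 1 M).filter Odd, ((M : ℝ) / (2 * a) - 1) =
      (M : ℝ) / 2 * ∑ a ∈ (Icc 1 M).filter Odd, (1 : ℝ) / a - ((Icc 1 M).filter Odd).card := by
    rw [Finset.sum_sub_distrib, Finset.mul_sum, Finset.sum_const, nsmul_eq_mul, mul_one]
    congr 1
    refine Finset.sum_congr rfl fun a _ => ?_
    ring
  have h4 : (((Icc 1 M).filter Odd).card : ℝ) ≤ M := by
    have : ((Icc 1 M).filter Odd).card ≤ (Icc 1 M).card := Finset.card_filter_le _ _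
    simp only [Nat.card_Icc, add_tsub_cancel_right] at this
    exact_mod_cast this
  have h5 := sum_inv_odd_ge M hM
  have hM0 : (0 : ℝ) ≤ M := Nat.cast_nonneg M
  have hlog2 : Real.log 2 < 1 := by have := Real.log_two_lt_d9; linarith
  have h6 : (M : ℝ) / 4 * Real.log M - 2 * M ≤ (M : ℝ) / 2 * ∑ a ∈ (Icc 1 M).filter Odd, (1 : ℝ) / a - M := by
    have := mul_le_mul_of_nonneg_left h5 (by positivity : (0 : ℝ) ≤ M / 2)
    have hlog2' : 0 < Real.log 2 := Real.log_pos one_lt_two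
    nlinarith
  calc (M : ℝ) / 4 * Real.log M - 2 * M ≤ (M : ℝ) / 2 * ∑ a ∈ (Icc 1 M).filter Odd, (1 : ℝ) / a - M := h6
    _ ≤ (M : ℝ) / 2 * ∑ a ∈ (Icc 1 M).filter Odd, (1 : ℝ) / a - ((Icc 1 M).filter Odd).card := by linarith
    _ = ∑ a ∈ (Icc 1 M).filter Odd, ((M : ℝ) / (2 * a) - 1) := h3.symm
    _ ≤ ∑ a ∈ (Icc 1 M).filter Odd, (((Icc 1 (M / a)).filter Odd).card : ℝ) := Finset.sum_le_sum h2
    _ ≤ _ := h1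

end Summit.Parity.BatemanHorn.Theorems.LSDRealSegment.Negative
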